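import Mathlib.Analysis.SpecificLimits.Basic
import Mathlib.Analysis.SpecialFunctions.Pow.Real
import HarnessLib

/-!
# A doubling lemma for nonnegative real sequences

This file proves the real-sequence heart of a multiple-reflection (chessboard) estimate.
If `a : ℕ → ℝ` is nonnegative, satisfies the Cauchy–Schwarz type doubling inequality
`a j ^ 2 ≤ N * a (2 * j)` for `j ≥ 1`, and the a priori growth bound
`a j ^ 2 ≤ M * R ^ (2 * j)` with `R ≥ 1`, then `a 1 ≤ N * R`.

In the application `a j = ‖A ^ j ψ‖` for a symmetric operator `A` and `N = ‖ψ‖`; the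
conclusion is `‖A ψ‖ ≤ ‖ψ‖ * R`.

The proof iterates the doubling inequality along the powers of two, which gives
`a 1 ^ (2 ^ i) * N ≤ N ^ (2 ^ i) * a (2 ^ i)`; squaring and inserting the growth bound yields
`(a 1 / (N * R)) ^ (2 * 2 ^ i) ≤ M / N ^ 2` for all `i`.  If `N * R < a 1`, this contradicts
the unboundedness of the powers of a real number `> 1` (the degenerate case `N = 0` forces
`a 1 = 0` directly).
-/

noncomputable section

namespace Summit.CriticalPhenomena.Ising3DConformalLimit.Cruxes.RotationUpgradeFromTwoPoint.NullLaplacianEdgeGaussianity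

/-- One doubling step: the bound `a 1 ^ n * N ≤ N ^ n * a n` at `n ≥ 1` implies the same
bound at `2 * n`. -/
theorem doubling_step (a : ℕ → ℝ) (N : ℝ) (ha : ∀ j, 0 ≤ a j) (hN : 0 ≤ N)
    (hstep : ∀ j, 1 ≤ j → a j ^ 2 ≤ N * a (2 * j)) (n : ℕ) (hn : 1 ≤ n)
    (ih : a 1 ^ n * N ≤ N ^ n * a n) :
    a 1 ^ (2 * n) * N ≤ N ^ (2 * n) * a (2 * n) := by
  rcases hN.eq_or_lt with h | hNpos
  · subst h
    have h2n : 2 * n ≠ 0 := by omega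
    simp [zero_pow h2n]
  · have h0 : 0 ≤ a 1 ^ n * N := mul_nonneg (pow_nonneg (ha 1) _) hN
    have hsq : (a 1 ^ n * N) ^ 2 ≤ (N ^ n * a n) ^ 2 := pow_le_pow_left₀ h0 ih 2
    have hst : a n ^ 2 ≤ N * a (2 * n) := hstep n hn
    have key : a 1 ^ (2 * n) * N * N ≤ N ^ (2 * n) * a (2 * n) * N := by
      calc a 1 ^ (2 * n) * N * N = (a 1 ^ n * N) ^ 2 := by ring
        _ ≤ (N ^ n * a n) ^ 2 := hsq
        _ = N ^ (2 * n) * a n ^ 2 := by ring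
        _ ≤ N ^ (2 * n) * (N * a (2 * n)) := mul_le_mul_of_nonneg_left hst (pow_nonneg hN _)
        _ = N ^ (2 * n) * a (2 * n) * N := by ring
    exact le_of_mul_le_mul_right key hNpos

/-- Iterated doubling along the powers of two:
`a 1 ^ (2 ^ i) * N ≤ N ^ (2 ^ i) * a (2 ^ i)`. -/
theorem doubling_iterate (a : ℕ → ℝ) (N : ℝ) (ha : ∀ j, 0 ≤ a j) (hN : 0 ≤ N)
    (hstep : ∀ j, 1 ≤ j → a j ^ 2 ≤ N * a (2 * j)) (i : ℕ) :
    a 1 ^ (2 ^ i) * N ≤ N ^ (2 ^ i) * a (2 ^ i) := by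
  induction i with
  | zero =>
    simp only [pow_zero, pow_one]
    exact (mul_comm _ _).le
  | succ i ih =>
    rw [pow_succ' (2 : ℕ) i]
    exact doubling_step a N ha hN hstep (2 ^ i) Nat.one_le_two_pow ih

/-- The iterated bound, squared and combined with the growth bound, in ratio form:
`(a 1 / (N * R)) ^ (2 * 2 ^ i) ≤ M / N ^ 2` (for `0 < N`, `1 ≤ R`). -/
theorem doubling_ratio_bound (a : ℕ → ℝ) (N R M : ℝ) (ha : ∀ j, 0 ≤ a j) (hN : 0 < N)
    (hR : 1 ≤ R) (hstep : ∀ j, 1 ≤ j → a j ^ 2 ≤ N * a (2 * j))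
    (hgrow : ∀ j, a j ^ 2 ≤ M * R ^ (2 * j)) (i : ℕ) :
    (a 1 / (N * R)) ^ (2 * 2 ^ i) ≤ M / N ^ 2 := by
  have hiter : a 1 ^ (2 ^ i) * N ≤ N ^ (2 ^ i) * a (2 ^ i) :=
    doubling_iterate a N ha hN.le hstep i
  have h0 : 0 ≤ a 1 ^ (2 ^ i) * N := mul_nonneg (pow_nonneg (ha 1) _) hN.le
  have hsq : (a 1 ^ (2 ^ i) * N) ^ 2 ≤ (N ^ (2 ^ i) * a (2 ^ i)) ^ 2 :=
    pow_le_pow_left₀ h0 hiter 2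
  have hc : 0 < N * R := mul_pos hN (lt_of_lt_of_le one_pos hR)
  have key : a 1 ^ (2 * 2 ^ i) * N ^ 2 ≤ M * (N * R) ^ (2 * 2 ^ i) := by
    calc a 1 ^ (2 * 2 ^ i) * N ^ 2 = (a 1 ^ (2 ^ i) * N) ^ 2 := by ring
      _ ≤ (N ^ (2 ^ i) * a (2 ^ i)) ^ 2 := hsq
      _ = N ^ (2 * 2 ^ i) * a (2 ^ i) ^ 2 := by ring
      _ ≤ N ^ (2 * 2 ^ i) * (M * R ^ (2 * 2 ^ i)) :=
          mul_le_mul_of_nonneg_left (hgrow (2 ^ i)) (pow_nonneg hN.le _)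
      _ = M * (N * R) ^ (2 * 2 ^ i) := by ring
  rw [div_pow, div_le_div_iff₀ (pow_pos hc _) (pow_pos hN 2)]
  exact key

/-- W-doubling: the real-sequence lemma.  If `a ≥ 0`, `a j ^ 2 ≤ N * a (2 * j)` for `j ≥ 1`
and `a j ^ 2 ≤ M * R ^ (2 * j)` with `R ≥ 1`, then `a 1 ≤ N * R`. -/
theorem stub_doubling :
    ∀ (a : ℕ → ℝ) (N R M : ℝ), (∀ j, 0 ≤ a j) → 0 ≤ N → 1 ≤ R → 0 ≤ M →
      (∀ j, 1 ≤ j → a j ^ 2 ≤ N * a (2 * j)) → (∀ j, a j ^ 2 ≤ M * R ^ (2 * j)) → a 1 ≤ N * R := by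
  intro a N R M ha hN hR _hM hstep hgrow
  refine not_lt.mp fun hlt => ?_
  rcases hN.eq_or_lt with h | hNpos
  · -- Degenerate case `N = 0`: the doubling inequality at `j = 1` forces `a 1 = 0`.
    subst h
    have h1 : a 1 ^ 2 ≤ 0 := by
      have h := hstep 1 le_rfl
      rwa [zero_mul] at h
    have hpos : 0 < a 1 := by rwa [zero_mul] at hlt
    exact absurd h1 (not_le.mpr (pow_pos hpos 2))
  · -- Main case `0 < N`: the ratio `θ = a 1 / (N * R) > 1` has bounded powers, absurd.
    have hc : 0 < N * R := mul_pos hNpos (lt_of_lt_of_le one_pos hR)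
    have hθ : 1 < a 1 / (N * R) := (one_lt_div hc).mpr hlt
    obtain ⟨k, hk⟩ := pow_unbounded_of_one_lt (M / N ^ 2) hθ
    have hk2 : k ≤ 2 * 2 ^ k :=
      (Nat.lt_two_pow_self (n := k)).le.trans (Nat.le_mul_of_pos_left _ two_pos)
    have hmono : (a 1 / (N * R)) ^ k ≤ (a 1 / (N * R)) ^ (2 * 2 ^ k) :=
      pow_le_pow_right₀ hθ.le hk2
    have hbound := doubling_ratio_bound a N R M ha hNpos hR hstep hgrow k
    exact absurd (hk.trans_le (hmono.trans hbound)) (lt_irrefl _)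

end Summit.CriticalPhenomena.Ising3DConformalLimit.Cruxes.RotationUpgradeFromTwoPoint.NullLaplacianEdgeGaussianity

end
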